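import Summits.Ventures.LatticeQCDFlow.Scaling.ReplicaExchangeModeTorpid

/-!
HONEST FRAMING: exact (Metropolis-corrected) sampling algorithms for lattice gauge theory; figures
of merit are autocorrelation/cost numbers at stated couplings and volumes; no continuum-physics
claim.

# SweepSchemeSectorCeiling — PARALLEL UPDATES DO NOT BEAT THE LINEAR LAW: WITH ALL `K+1` REPLICAS UPDATED
# SIMULTANEOUSLY EVERY STEP (`Swp = ⊗_k M_k`, the practitioners' sweep / wall-clock accounting) AND ANY EXCHANGE MOVE
# `Q` PRESERVING THE NUMBER OF REPLICAS IN A SECTOR `A`, `Gap(t·Q + (1−t)·Swp) ≤ (1−t)·Σ_k Q_k(A,Aᶜ)/Σ_k μ_k(A)μ_k(Aᶜ)`;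
# `K` SECTOR-FROZEN COLD REPLICAS: `Gap ≤ (1−t)·Q_0(A,Aᶜ)/(K·v) ≤ (1−t)·min{μ_0(A), μ_0(Aᶜ)}/(K·v)` PER SWEEP
# (lean-2 GEN-20, ours)

Venture-side (OURS).  Cell `lqcd-flow` (pub-lqcd), unit `pub-lqcd-lean-2-g20`, 2026-08-25.  Chapter H (universal
ceilings), companion of `ExchangeSchemeSectorCeiling` (one uniformly chosen replica updated per step: order `K²`) and
`ExchangeSchemeHandoverCeiling` (any update weights: order `K`).  Replica-exchange codes run the `K+1` replicas on
`K+1` workers and count time in SWEEPS: every replica makes one step of its own update, simultaneously, then an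
exchange is attempted.  State space `Fin (K+1) → S` (`S` finite), law `π̃ = ⊗_k μ_k` (`tensorFun μ`, positive
probability vectors), replica updates `M_k` (row-stochastic, `μ_k`-reversible), the SWEEP KERNEL
`sweepKernel M (x,y) = Π_k M_k(x_k,y_k)` (all replicas move independently in one step), an EXCHANGE MOVE `Q` (any
row-stochastic `π̃`-reversible kernel with `Q(x,y) ≠ 0 ⇒ #{k : y_k ∈ A} = #{k : x_k ∈ A}`: swaps on any graph in
any number, sector-preserving maps between couplings, any acceptance rule), and the sampler
`P(x,y) = t·Q(x,y) + (1−t)·sweepKernel M (x,y)`.  `Q_k(A,Aᶜ) = edgeMeasure (μ k) (M k) A Aᶜ`;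
`f_A^{(ν)} = 1_{Aᶜ} − ν(Aᶜ)` is the Literature's `bottleneckTestFun ν A`.

## What is proved

* §1 `sweepKernel` (def): `sweepKernel_apply`, row-stochastic, DETAILED BALANCE with `π̃`, `sweepKernel_mulVec_additive`
  (`Swp(Σ_k g_k∘x_k) = Σ_k (M_k g_k)∘x_k`), and **`dirichletForm_sweepKernel_additive`: for coordinatewise mean-zero
  `g_k`, `𝓔_{Swp}(Σ_k g_k(x_k)) = Σ_k 𝓔_{M_k}(g_k)`** — the sweep's form is the SUM of the replicas' forms (no
  `1/(K+1)`).
* §2 the sweep scheme `t·Q + (1−t)·Swp`: row-stochastic, `π̃`-reversible, `𝓔_P = t𝓔_Q + (1−t)𝓔_{Swp}`; the centred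
  sector count `G_A(x) = Σ_k f_A^{(μ_k)}(x_k)` has `𝓔_{Swp}(G_A) = Σ_k Q_k(A,Aᶜ)` and `𝓔_Q(G_A) = 0`.
* §3 **`sweepScheme_spectralGap_le_sectorCount`**: `Gap(P) ≤ (1−t)·Σ_k Q_k(A,Aᶜ)/Σ_k μ_k(A)μ_k(Aᶜ)`;
  **`sweepSchemeFrozen_spectralGap_le_hot`**: `K ≥ 1` sector-frozen cold replicas (`Q_k(A,Aᶜ) = 0`,
  `μ_k(A)μ_k(Aᶜ) ≥ v > 0`, `k ≠ 0`) ⇒ `Gap(P) ≤ (1−t)·Q_0(A,Aᶜ)/(K·v)`; **`sweepSchemeFrozen_spectralGap_le_linear`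
  (THE LINEAR LAW IN SWEEPS)**: `Gap(P) ≤ (1−t)·min{μ_0(A), μ_0(Aᶜ)}/(K·v)`.

Reading (no numerics implied): updating every replica at every step removes the factor `K+1` of
`ExchangeSchemeSectorCeiling` and nothing more: per sweep at most one fresh sector label is minted (by the tunnelling
replica's own step, flow `Q_0(A,Aᶜ) ≤ ½`), and `K` frozen clients wait for it — the exact sampler needs order `K`
SWEEPS (order `K²` replica updates of work, order `K` wall-clock on `K+1` workers) whatever the exchange scheme.
NOT CLAIMED: floors; several tunnelling replicas (the general `Σ_k Q_k` form covers them but is not specialised);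
continuous configuration spaces; anything measured.  Literature grade (cell rule): KNOWN MECHANISM (test-function
ceilings; tensorisation of Dirichlet forms, Levin–Peres–Wilmer §12.4/§13.2), NEW TYPING (sweep accounting for
exchange schemes); nothing cited as a fact; no new bib keys.
-/

noncomputable section

open Finset Function Matrix
open Literature.Probability.MarkovChains

namespace Summit.Ventures.LatticeQCDFlow.Scaling

variable {S : Type*} [Fintype S] [DecidableEq S] {K : ℕ}

/-! ## §1 The sweep kernel: all replicas move at once -/

/-- THE SWEEP KERNEL: every replica `k` makes one step of its own kernel `M_k`, independently —
`sweepKernel M x y = Π_k M_k(x_k, y_k)` (the row at `x` is the product law of the rows `M_k(x_k,·)`). [ours] -/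
def sweepKernel (M : Fin (K + 1) → S → S → ℝ) : Matrix (Fin (K + 1) → S) (Fin (K + 1) → S) ℝ :=
  Matrix.of fun x => tensorFun (fun k => M k (x k))

section Sweep

variable {μ : Fin (K + 1) → S → ℝ} {M : Fin (K + 1) → S → S → ℝ}

omit [Fintype S] [DecidableEq S] in
/-- Entries of the sweep kernel. [ours] -/
theorem sweepKernel_apply (M : Fin (K + 1) → S → S → ℝ) (x y : Fin (K + 1) → S) :
    sweepKernel M x y = ∏ k, M k (x k) (y k) := rfl

omit [DecidableEq S] in
/-- The sweep kernel is a transition matrix when every `M_k` is. [ours] -/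
theorem sweepKernel_isRowStochastic (hM : ∀ k, IsRowStochastic (M k)) : IsRowStochastic (sweepKernel M) := by
  refine ⟨fun x y => ?_, fun x => ?_⟩
  · rw [sweepKernel_apply]; exact prod_nonneg fun k _ => (hM k).1 _ _
  · exact sum_tensorFun_eq_one (fun k => M k (x k)) fun k => (hM k).2 (x k)

omit [Fintype S] [DecidableEq S] in
/-- **The sweep kernel is in DETAILED BALANCE with the product law** (`M_k` `μ_k`-reversible). [ours] -/
theorem sweepKernel_detailedBalance [Fintype S] (hMrev : ∀ k, DetailedBalance (μ k) (M k)) :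
    DetailedBalance (tensorFun μ) (sweepKernel M) := by
  intro x y
  rw [sweepKernel_apply, sweepKernel_apply]
  unfold tensorFun
  rw [← Finset.prod_mul_distrib, ← Finset.prod_mul_distrib]
  exact prod_congr rfl fun k _ => hMrev k (x k) (y k)

omit [DecidableEq S] in
/-- **The sweep acts coordinatewise on additive observables:** `(Swp F)(x) = Σ_k (M_k g_k)(x_k)` for
`F(x) = Σ_k g_k(x_k)` (`M_k` row-stochastic). [ours] -/
theorem sweepKernel_mulVec_additive (hM : ∀ k, IsRowStochastic (M k)) (g : Fin (K + 1) → S → ℝ)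
    (x : Fin (K + 1) → S) :
    (sweepKernel M *ᵥ fun y => ∑ k, g k (y k)) x = ∑ k, (M k *ᵥ g k) (x k) := by
  change ∑ y, tensorFun (fun k => M k (x k)) y * ∑ k, g k (y k) = _
  rw [sum_tensorFun_mul_additive (fun k => M k (x k)) (fun k => (hM k).2 (x k)) g]
  rfl

omit [DecidableEq S] in
/-- **THE SWEEP'S DIRICHLET FORM OF AN ADDITIVE OBSERVABLE IS THE SUM OF THE REPLICAS' FORMS:** for
`E_{μ_k} g_k = 0`, `𝓔_π̃(Swp; Σ_k g_k(x_k)) = Σ_k 𝓔_{μ_k}(M_k; g_k)` (`M_k` row-stochastic, `μ_k`-reversible, `μ_k`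
probability vectors). [folklore: tensorisation, cf. Levin–Peres–Wilmer §12.4; typed here] -/
theorem dirichletForm_sweepKernel_additive (hμ1 : ∀ k, ∑ u, μ k u = 1) (hM : ∀ k, IsRowStochastic (M k))
    (hMrev : ∀ k, DetailedBalance (μ k) (M k)) (g : Fin (K + 1) → S → ℝ) (hg0 : ∀ k, ∑ u, μ k u * g k u = 0) :
    dirichletForm (tensorFun μ) (sweepKernel M) (fun x => ∑ k, g k (x k))
      = ∑ k, dirichletForm (μ k) (M k) (g k) := by
  have hP := sweepKernel_isRowStochastic hM
  have hst : IsStationary (tensorFun μ) (sweepKernel M) := (sweepKernel_detailedBalance hMrev).isStationary hP.2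
  rw [dirichletForm_eq hP hst, piInner_tensorFun_additive μ hμ1 g hg0]
  have hk : ∀ k, dirichletForm (μ k) (M k) (g k) = piInner (μ k) (g k) (g k) - piInner (μ k) (g k) (M k *ᵥ g k) :=
    fun k => dirichletForm_eq (hM k) ((hMrev k).isStationary (hM k).2) (g k)
  simp_rw [hk]
  rw [Finset.sum_sub_distrib]
  congr 1
  -- `⟨F, Swp F⟩_π̃ = Σ_k ⟨g_k, M_k g_k⟩_{μ_k}`: off-diagonal pairs vanish by the zero means
  have hPF : (sweepKernel M *ᵥ fun y => ∑ k, g k (y k)) = fun x => ∑ k, (M k *ᵥ g k) (x k) :=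
    funext fun x => sweepKernel_mulVec_additive hM g x
  rw [hPF]
  unfold piInner
  have hsq : ∀ x : Fin (K + 1) → S, tensorFun μ x * ((∑ k, g k (x k)) * ∑ l, (M l *ᵥ g l) (x l))
      = ∑ k, ∑ l, tensorFun μ x * (g k (x k) * (M l *ᵥ g l) (x l)) := by
    intro x
    rw [Finset.sum_mul_sum, Finset.mul_sum]
    exact sum_congr rfl fun k _ => by rw [Finset.mul_sum]
  simp_rw [hsq]
  rw [Finset.sum_comm]
  refine sum_congr rfl fun k _ => ?_
  rw [Finset.sum_comm, ← Finset.sum_erase_add univ _ (mem_univ k)]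
  have hdiag : ∑ x : Fin (K + 1) → S, tensorFun μ x * (g k (x k) * (M k *ᵥ g k) (x k))
      = ∑ u, μ k u * (g k u * (M k *ᵥ g k) u) :=
    sum_tensorFun_mul_apply μ hμ1 k (fun u => g k u * (M k *ᵥ g k) u)
  have hoff : ∑ l ∈ univ.erase k, ∑ x : Fin (K + 1) → S, tensorFun μ x * (g k (x k) * (M l *ᵥ g l) (x l)) = 0 := by
    refine Finset.sum_eq_zero fun l hl => ?_
    rw [sum_tensorFun_mul_two μ hμ1 (Finset.ne_of_mem_erase hl).symm (g k) (fun v => (M l *ᵥ g l) v), hg0 k,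
      zero_mul]
  rw [hoff, hdiag, zero_add]

/-- **`𝓔_{Swp}(G_A) = Σ_k Q_k(A,Aᶜ)`** for the centred sector count `G_A(x) = Σ_k f_A^{(μ_k)}(x_k)`. [ours] -/
theorem sweepKernel_dirichletForm_sectorCount (hμ1 : ∀ k, ∑ u, μ k u = 1) (hM : ∀ k, IsRowStochastic (M k))
    (hMrev : ∀ k, DetailedBalance (μ k) (M k)) (A : Finset S) :
    dirichletForm (tensorFun μ) (sweepKernel M) (fun x => ∑ k, bottleneckTestFun (μ k) A (x k))
      = ∑ k, edgeMeasure (μ k) (M k) A Aᶜ := by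
  rw [dirichletForm_sweepKernel_additive hμ1 hM hMrev (fun k => bottleneckTestFun (μ k) A)
    (fun k => sum_mul_bottleneckTestFun (μ k) A)]
  exact sum_congr rfl fun k _ =>
    dirichletForm_bottleneckTestFun (hM k) ((hMrev k).isStationary (hM k).2) (hμ1 k) A

end Sweep

/-! ## §2 The sweep scheme `t·Q + (1−t)·Swp` -/

section Scheme

variable {μ : Fin (K + 1) → S → ℝ} {M : Fin (K + 1) → S → S → ℝ} {t : ℝ}
  {Q : Matrix (Fin (K + 1) → S) (Fin (K + 1) → S) ℝ}

omit [DecidableEq S] in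
/-- The sweep scheme is a transition matrix (`0 ≤ t ≤ 1`, `Q` and every `M_k` row-stochastic). [ours] -/
theorem sweepScheme_isRowStochastic (hQ : IsRowStochastic Q) (hM : ∀ k, IsRowStochastic (M k)) (ht0 : 0 ≤ t)
    (ht1 : t ≤ 1) : IsRowStochastic (fun x y : Fin (K + 1) → S => t * Q x y + (1 - t) * sweepKernel M x y) := by
  have hU := sweepKernel_isRowStochastic hM
  refine ⟨fun x y => add_nonneg (mul_nonneg ht0 (hQ.1 x y)) (mul_nonneg (by linarith) (hU.1 x y)), fun x => ?_⟩
  simp only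
  rw [Finset.sum_add_distrib, ← Finset.mul_sum, ← Finset.mul_sum, hQ.2 x, hU.2 x]
  ring

omit [DecidableEq S] in
/-- The sweep scheme is in detailed balance with the product law. [ours] -/
theorem sweepScheme_detailedBalance (hQrev : DetailedBalance (tensorFun μ) Q)
    (hMrev : ∀ k, DetailedBalance (μ k) (M k)) (t : ℝ) :
    DetailedBalance (tensorFun μ) (fun x y : Fin (K + 1) → S => t * Q x y + (1 - t) * sweepKernel M x y) := by
  intro x y
  have h1 := hQrev x y
  have h2 := sweepKernel_detailedBalance hMrev x y
  simp only
  linear_combination t * h1 + (1 - t) * h2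

omit [DecidableEq S] in
/-- `𝓔_P(F) = t·𝓔_Q(F) + (1−t)·𝓔_{Swp}(F)`. [ours] -/
theorem sweepScheme_dirichletForm (t : ℝ) (F : (Fin (K + 1) → S) → ℝ) :
    dirichletForm (tensorFun μ) (fun x y : Fin (K + 1) → S => t * Q x y + (1 - t) * sweepKernel M x y) F
      = t * dirichletForm (tensorFun μ) Q F + (1 - t) * dirichletForm (tensorFun μ) (sweepKernel M) F := by
  unfold dirichletForm
  rw [← mul_assoc, ← mul_assoc, mul_comm t, mul_comm (1 - t), mul_assoc, mul_assoc, ← mul_add]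
  congr 1
  rw [Finset.mul_sum, Finset.mul_sum, ← Finset.sum_add_distrib]
  refine sum_congr rfl fun x _ => ?_
  rw [Finset.mul_sum, Finset.mul_sum, ← Finset.sum_add_distrib]
  exact sum_congr rfl fun y _ => by ring

/-- **A count-preserving exchange move is invisible to the sector count:** `𝓔_Q(G_A) = 0`. [ours] -/
theorem exchange_dirichletForm_sectorCount_eq_zero (hμ1 : ∀ k, ∑ u, μ k u = 1) {A : Finset S}
    (hQA : ∀ x y, Q x y ≠ 0 → ∑ k, (if y k ∈ A then (1 : ℝ) else 0) = ∑ k, (if x k ∈ A then (1 : ℝ) else 0)) :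
    dirichletForm (tensorFun μ) Q (fun x => ∑ k, bottleneckTestFun (μ k) A (x k)) = 0 := by
  -- `G_A(x) − G_A(y) = #{y_k ∈ A} − #{x_k ∈ A}`
  have hsub : ∀ x y : Fin (K + 1) → S, (∑ k, bottleneckTestFun (μ k) A (x k)) - ∑ k, bottleneckTestFun (μ k) A (y k)
      = (∑ k, (if y k ∈ A then (1 : ℝ) else 0)) - ∑ k, (if x k ∈ A then (1 : ℝ) else 0) := by
    intro x y
    rw [← Finset.sum_sub_distrib, ← Finset.sum_sub_distrib]
    refine sum_congr rfl fun k _ => ?_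
    rw [bottleneckTestFun_eq (hμ1 k), bottleneckTestFun_eq (hμ1 k)]
    split_ifs <;> ring
  unfold dirichletForm
  rw [Finset.sum_eq_zero fun x _ => Finset.sum_eq_zero fun y _ => ?_, mul_zero]
  by_cases hq : Q x y = 0
  · rw [hq, mul_zero, zero_mul]
  · rw [hsub, hQA x y hq, sub_self]; ring

/-! ## §3 The ceilings per sweep -/

variable [Nontrivial S] (hμ : ∀ k x, 0 < μ k x) (hμ1 : ∀ k, ∑ u, μ k u = 1) (hM : ∀ k, IsRowStochastic (M k))
  (hMrev : ∀ k, DetailedBalance (μ k) (M k)) (ht0 : 0 ≤ t) (ht1 : t ≤ 1) (hQ : IsRowStochastic Q)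
  (hQrev : DetailedBalance (tensorFun μ) Q) {A : Finset S}
  (hQA : ∀ x y, Q x y ≠ 0 → ∑ k, (if y k ∈ A then (1 : ℝ) else 0) = ∑ k, (if x k ∈ A then (1 : ℝ) else 0))
include hμ hμ1 hM hMrev ht0 ht1 hQ hQrev hQA

/-- **THE SECTOR-COUNT CEILING PER SWEEP:** `Gap(t·Q + (1−t)·Swp) ≤ (1−t)·Σ_k Q_k(A,Aᶜ)/Σ_k μ_k(A)μ_k(Aᶜ)` for every
count-preserving exchange move (`0 ≤ t ≤ 1`, `|S| ≥ 2`, `Σ_k μ_k(A)μ_k(Aᶜ) > 0`). [ours] -/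
theorem sweepScheme_spectralGap_le_sectorCount (hA : 0 < ∑ k, (∑ u ∈ A, μ k u) * ∑ u ∈ Aᶜ, μ k u) :
    spectralGap (tensorFun μ) (fun x y : Fin (K + 1) → S => t * Q x y + (1 - t) * sweepKernel M x y)
      ≤ (1 - t) * (∑ k, edgeMeasure (μ k) (M k) A Aᶜ) / ∑ k, (∑ u ∈ A, μ k u) * ∑ u ∈ Aᶜ, μ k u := by
  have hP := sweepScheme_isRowStochastic hQ hM ht0 ht1
  have hDB := sweepScheme_detailedBalance hQrev hMrev t
  have hmean : ∑ x : Fin (K + 1) → S, tensorFun μ x * ∑ k, bottleneckTestFun (μ k) A (x k) = 0 := by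
    rw [sum_tensorFun_mul_additive μ hμ1]
    exact Finset.sum_eq_zero fun k _ => sum_mul_bottleneckTestFun (μ k) A
  have hnorm : piInner (tensorFun μ) (fun x => ∑ k, bottleneckTestFun (μ k) A (x k))
      (fun x => ∑ k, bottleneckTestFun (μ k) A (x k)) = ∑ k, (∑ u ∈ A, μ k u) * ∑ u ∈ Aᶜ, μ k u := by
    rw [piInner_tensorFun_additive μ hμ1 (fun k => bottleneckTestFun (μ k) A)
      (fun k => sum_mul_bottleneckTestFun (μ k) A)]
    exact sum_congr rfl fun k _ => piInner_bottleneckTestFun (hμ1 k) A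
  have hray := LevinPeres2017_lemma_13_7_rayleigh (tensorFun_pos hμ) (sum_tensorFun_eq_one μ hμ1) hP hDB hmean
  rw [hnorm, sweepScheme_dirichletForm, exchange_dirichletForm_sectorCount_eq_zero hμ1 hQA,
    sweepKernel_dirichletForm_sectorCount hμ1 hM hMrev, mul_zero, zero_add] at hray
  rw [le_div_iff₀ hA]
  exact hray

variable (hK : 1 ≤ K) {v : ℝ} (hvpos : 0 < v) (hv : ∀ k : Fin (K + 1), k ≠ 0 → v ≤ (∑ u ∈ A, μ k u) * ∑ u ∈ Aᶜ, μ k u)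
  (hfrozen : ∀ k : Fin (K + 1), k ≠ 0 → edgeMeasure (μ k) (M k) A Aᶜ = 0)
include hK hvpos hv hfrozen

/-- **`K` SECTOR-FROZEN COLD REPLICAS: `Gap(P) ≤ (1−t)·Q_0(A,Aᶜ)/(K·v)` PER SWEEP** (`Q_k(A,Aᶜ) = 0` and
`μ_k(A)μ_k(Aᶜ) ≥ v > 0` for `k ≠ 0`, `K ≥ 1`) — one fresh sector label per sweep at most, `K` clients. [ours] -/
theorem sweepSchemeFrozen_spectralGap_le_hot :
    spectralGap (tensorFun μ) (fun x y : Fin (K + 1) → S => t * Q x y + (1 - t) * sweepKernel M x y)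
      ≤ (1 - t) * edgeMeasure (μ 0) (M 0) A Aᶜ / (K * v) := by
  have hKpos : (0 : ℝ) < K := Nat.cast_pos.mpr (by omega)
  have hVge : (K : ℝ) * v ≤ ∑ k : Fin (K + 1), (∑ u ∈ A, μ k u) * ∑ u ∈ Aᶜ, μ k u := by
    rw [Fin.sum_univ_succ]
    have h0 : 0 ≤ (∑ u ∈ A, μ 0 u) * ∑ u ∈ Aᶜ, μ 0 u :=
      mul_nonneg (sum_nonneg fun u _ => (hμ _ u).le) (sum_nonneg fun u _ => (hμ _ u).le)
    have h1 : (K : ℝ) * v ≤ ∑ j : Fin K, (∑ u ∈ A, μ j.succ u) * ∑ u ∈ Aᶜ, μ j.succ u :=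
      calc (K : ℝ) * v = ∑ _j : Fin K, v := by rw [Finset.sum_const, Finset.card_univ, Fintype.card_fin, nsmul_eq_mul]
        _ ≤ _ := sum_le_sum fun j _ => hv j.succ (Fin.succ_ne_zero j)
    linarith
  have h := sweepScheme_spectralGap_le_sectorCount hμ hμ1 hM hMrev ht0 ht1 hQ hQrev hQA
    (lt_of_lt_of_le (mul_pos hKpos hvpos) hVge)
  have hsum : ∑ k : Fin (K + 1), edgeMeasure (μ k) (M k) A Aᶜ = edgeMeasure (μ 0) (M 0) A Aᶜ := by
    rw [Finset.sum_eq_single (0 : Fin (K + 1)) (fun k _ hk => hfrozen k hk) (fun h => absurd (mem_univ _) h)]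
  rw [hsum] at h
  have hnum : 0 ≤ (1 - t) * edgeMeasure (μ 0) (M 0) A Aᶜ :=
    mul_nonneg (by linarith) (edgeMeasure_nonneg (fun u => (hμ 0 u).le) (hM 0).1 A Aᶜ)
  exact h.trans (div_le_div_of_nonneg_left hnum (by positivity) hVge)

/-- **THE LINEAR LAW IN SWEEPS: `Gap(P) ≤ (1−t)·min{μ_0(A), μ_0(Aᶜ)}/(K·v)`** — whatever the hot replica's update and
whatever the exchange scheme (the flow `Q_0(A,Aᶜ)` is at most `μ_0(A)` and, by stationarity, at most `μ_0(Aᶜ)`). [ours] -/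
theorem sweepSchemeFrozen_spectralGap_le_linear :
    spectralGap (tensorFun μ) (fun x y : Fin (K + 1) → S => t * Q x y + (1 - t) * sweepKernel M x y)
      ≤ (1 - t) * min (∑ u ∈ A, μ 0 u) (∑ u ∈ Aᶜ, μ 0 u) / (K * v) := by
  have hKpos : (0 : ℝ) < K := Nat.cast_pos.mpr (by omega)
  refine (sweepSchemeFrozen_spectralGap_le_hot hμ hμ1 hM hMrev ht0 ht1 hQ hQrev hQA hK hvpos hv hfrozen).trans ?_
  refine div_le_div_of_nonneg_right (mul_le_mul_of_nonneg_left (le_min ?_ ?_) (by linarith)) (by positivity)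
  · rw [← edgeMeasure_univ_right (hM 0) (μ 0) A, ← edgeMeasure_add_compl_right (μ 0) (M 0) A A]
    exact le_add_of_nonneg_left (edgeMeasure_nonneg (fun u => (hμ 0 u).le) (hM 0).1 A A)
  · rw [edgeMeasure_compl_comm (hM 0) ((hMrev 0).isStationary (hM 0).2) A,
      ← edgeMeasure_univ_right (hM 0) (μ 0) Aᶜ, ← edgeMeasure_add_compl_right (μ 0) (M 0) Aᶜ A]
    exact le_add_of_nonneg_right (edgeMeasure_nonneg (fun u => (hμ 0 u).le) (hM 0).1 _ _)

end Scheme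

end Summit.Ventures.LatticeQCDFlow.Scaling

end
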